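import Mathlib.Analysis.SpecialFunctions.Pow.Real
import Mathlib.Analysis.Convex.SpecificFunctions.Basic
import Mathlib.Analysis.Complex.ExponentialBounds
import Mathlib.Algebra.Order.BigOperators.Group.Finset
import HarnessLib

/-!
# Krachun–Panagiotis's recurrence ⇒ polynomial decay step, with explicit constants

Topic `Literature/Probability/RandomPlanarGeometry`. Source: D. Krachun, C. Panagiotis, *Quantitative
sub-ballisticity of self-avoiding walk on the hexagonal lattice*, Ann. Probab. 54 (2026),
arXiv:2310.17299 (Oct 2023), §3.3, **Lemma 3.4**: "Let `(D_k)_{k≥0}` be a non-increasing sequence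
such that `D_k ∈ (0, C]`, and let `(G_k)_{k≥1}` be such that `G_k > 0`. Assume that for all `T ≥ 1`
[(12)] and also that `Σ_{k≥T} G_k ≤ 2D_{2T-1}`. Then for `ε = 10^{-10}` one has `D_T ≤ 100·T^{-ε}` for
all `T ≥ 1`" — "purely analytical … The constants have not been optimized".

This file proves the same kind of statement from the paper's inequality **(10)** (Lemma 3.3; valid for
every `T ≥ 1` by the first sentence of the proof of Corollary 3.1, p.15), which is what (12) is derived
from: `T² D_{18T}³ ≤ K · (D_{⌈(T+1)/2⌉}/D_{10T} · Σ_{i ≤ ⌊5T/2⌋} D_i)² · Σ_{k=T}^{21T} G_k`, together with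
the tail bound of Lemma 2.2, `Σ_{T ≤ k < N} G_k ≤ K₂ D_{2T-1}`, with the constants TRACKED:
**`decay_of_recurrence`** — for every `J ≥ 1` and `ε > 0` with `5ε·log(72·22^{J-1}) ≤ 1` and
`(25/4)·e·K·K₂·(1/(1-ε)+1/100)² ≤ J`, `D_T ≤ 100·C₀·T^{-ε}` for all `T ≥ 1`. With the paper's `K = 2^{15}`,
`K₂ = cos(π/8)/(2cos(3π/8))` this allows `ε = 9.3·10⁻⁸` (`J = 690 000`), about `930×` the printed `10^{-10}`
(instantiated in `HexSAWBridgeDecayKP*.lean`). The hypotheses of Lemma 3.4 as printed admit the power law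
`D_T = C·T^{-ε₀}` with `ε₀ ≈ 1.3·10⁻⁶`, so no lemma of this type can do better than that order.

Proof: the paper's (pigeonhole over `J` blocks `[22^j T₀, 21·22^j T₀]`; power-law induction hypothesis
with `Σ_{i=1}^{n} i^{-ε} ≤ n^{1-ε}/(1-ε)`), as a strong induction on `T` itself (no lattice `22^{Js}`,
no interpolation loss (13)), with the dichotomy "`D_{10t} < λ·D_{⌈(t+1)/2⌉}` or the ratio in (10) is
`≤ 1/λ`", `λ = (72·22^{J-1})^{-ε}`; `(72·22^{J-1})^{5ε} ≤ e` is the only place the exponent enters.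
Everything here is about real sequences; no lattice object is used.
-/

noncomputable section

open Real Finset

namespace Literature.Probability.RandomPlanarGeometry

namespace KrachunPanagiotis

/-! ### The power sum `Σ_{i=1}^{n} i^{-ε} ≤ n^{1-ε}/(1-ε)` -/

/-- Bernoulli step: `(m-1)^{1-ε} ≤ m^{1-ε} - (1-ε)·m^{-ε}` for `m ≥ 1`, `0 ≤ ε ≤ 1`
(`(1 - 1/m)^{1-ε} ≤ 1 - (1-ε)/m`). [folklore] -/
private theorem rpow_pred_le {ε : ℝ} (hε0 : 0 ≤ ε) (hε1 : ε ≤ 1) {m : ℝ} (hm : 1 ≤ m) :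
    (m - 1) ^ (1 - ε) ≤ m ^ (1 - ε) - (1 - ε) * m ^ (-ε) := by
  have hm0 : 0 < m := by linarith
  have hb := rpow_one_add_le_one_add_mul_self (s := -1 / m) (p := 1 - ε)
    (by rw [neg_div, neg_le_neg_iff]; exact (div_le_one hm0).2 hm) (by linarith) (by linarith)
  have hsplit : m - 1 = m * (1 + -1 / m) := by field_simp; ring
  have h1 : 0 ≤ 1 + -1 / m := by
    rw [neg_div, ← sub_eq_add_neg, sub_nonneg]; exact (div_le_one hm0).2 hm
  rw [hsplit, Real.mul_rpow hm0.le h1]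
  have hmpow : 0 ≤ m ^ (1 - ε) := Real.rpow_nonneg hm0.le _
  have hneg : m ^ (-ε) = m ^ (1 - ε) * (1 / m) := by
    rw [show (-ε) = (1 - ε) + (-1) by ring, Real.rpow_add hm0, Real.rpow_neg_one, one_div]
  calc m ^ (1 - ε) * (1 + -1 / m) ^ (1 - ε) ≤ m ^ (1 - ε) * (1 + (1 - ε) * (-1 / m)) :=
        mul_le_mul_of_nonneg_left hb hmpow
    _ = m ^ (1 - ε) - (1 - ε) * m ^ (-ε) := by rw [hneg]; ring

/-- **`Σ_{i<n} (i+1)^{-ε} ≤ n^{1-ε}/(1-ε)`** (`0 ≤ ε < 1`), i.e. `Σ_{i=1}^{n} i^{-ε} ≤ ∫₀ⁿ x^{-ε} dx`.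
[cite: KrachunPanagiotis2026, proof of Lemma 3.4 ("Σ_{i=1}^{3T} i^{-ε} ≤ ∫_0^{3T} x^{-ε} dx")] -/
theorem sum_rpow_neg_succ_le {ε : ℝ} (hε0 : 0 ≤ ε) (hε1 : ε < 1) (n : ℕ) :
    ∑ i ∈ range n, ((i : ℝ) + 1) ^ (-ε) ≤ (n : ℝ) ^ (1 - ε) / (1 - ε) := by
  have h1ε : 0 < 1 - ε := by linarith
  induction n with
  | zero => simp [Real.zero_rpow h1ε.ne']
  | succ n ih =>
    rw [sum_range_succ]
    have hstep := rpow_pred_le hε0 hε1.le (m := (n : ℝ) + 1) (by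
      have : (0 : ℝ) ≤ n := n.cast_nonneg; linarith)
    rw [add_sub_cancel_right] at hstep
    push_cast
    rw [le_div_iff₀ h1ε] at ih ⊢
    nlinarith [Real.rpow_nonneg (show (0:ℝ) ≤ (n:ℝ) + 1 by positivity) (-ε)]

/-! ### The abstract recurrence ⇒ decay theorem -/


/-- The geometric blocks `[22^j T₀, 21·22^j T₀]`, `j < J`, are pairwise disjoint. [cite: KrachunPanagiotis2026, proof of Lemma 3.4 ("T_j := 22^{…+j}")] -/
theorem blocks_disjoint {T₀ : ℕ} (hT₀ : 1 ≤ T₀) (J : ℕ) :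
    Set.PairwiseDisjoint (↑(range J) : Set ℕ)
      (fun j => Icc (22 ^ j * T₀) (21 * (22 ^ j * T₀))) := by
  have hc : ∀ {i j : ℕ}, i < j → 21 * (22 ^ i * T₀) < 22 ^ j * T₀ := by
    intro i j h
    have hp : 22 ^ (i + 1) ≤ 22 ^ j := Nat.pow_le_pow_right (by norm_num) h
    have h1 : 22 ^ (i + 1) * T₀ ≤ 22 ^ j * T₀ := Nat.mul_le_mul_right _ hp
    have h2 : 22 ^ (i + 1) * T₀ = 22 * (22 ^ i * T₀) := by ring
    have hpos : 0 < 22 ^ i * T₀ := by positivity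
    rw [h2] at h1
    omega
  intro i _ j _ hij
  rw [Function.onFun, disjoint_left]
  intro x hx hx'
  rw [mem_Icc] at hx hx'
  rcases lt_or_gt_of_ne hij with h | h
  · have := hc h; omega
  · have := hc h; omega

/-- The blocks lie in `[T₀, 22^J T₀)`. [cite: KrachunPanagiotis2026, proof of Lemma 3.4] -/
theorem blocks_subset {T₀ : ℕ} (hT₀ : 1 ≤ T₀) (J : ℕ) :
    (range J).biUnion (fun j => Icc (22 ^ j * T₀) (21 * (22 ^ j * T₀))) ⊆ Ico T₀ (22 ^ J * T₀) := by
  intro x hx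
  rw [mem_biUnion] at hx
  obtain ⟨j, hj, hx⟩ := hx
  rw [mem_range] at hj
  rw [mem_Icc] at hx
  rw [mem_Ico]
  have h1 : 1 ≤ 22 ^ j := Nat.one_le_pow _ _ (by norm_num)
  have h1' : T₀ ≤ 22 ^ j * T₀ := Nat.le_mul_of_pos_left _ (by omega)
  have hp : 22 ^ (j + 1) ≤ 22 ^ J := Nat.pow_le_pow_right (by norm_num) hj
  have h2 : 22 ^ (j + 1) * T₀ ≤ 22 ^ J * T₀ := Nat.mul_le_mul_right _ hp
  have h3 : 22 ^ (j + 1) * T₀ = 22 * (22 ^ j * T₀) := by ring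
  have hpos : 0 < 22 ^ j * T₀ := by positivity
  rw [h3] at h2
  constructor <;> omega

/-- **Pigeonhole over the blocks**: one of the `J` block sums is at most `K₂ D_{2T₀-1}/J`.
[cite: KrachunPanagiotis2026, proof of Lemma 3.4 ("for at least one j₀ … ≤ 10⁻⁹ · 2D_{T₀}")] -/
theorem exists_small_block {D G : ℕ → ℝ} {K₂ : ℝ} (hG : ∀ k, 0 ≤ G k)
    (htail : ∀ T : ℕ, 1 ≤ T → ∀ N : ℕ, ∑ k ∈ Ico T N, G k ≤ K₂ * D (2 * T - 1))
    {T₀ J : ℕ} (hT₀ : 1 ≤ T₀) (hJ : 1 ≤ J) :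
    ∃ j ∈ range J, ∑ k ∈ Icc (22 ^ j * T₀) (21 * (22 ^ j * T₀)), G k ≤ K₂ * D (2 * T₀ - 1) / J := by
  apply exists_le_of_sum_le (nonempty_range_iff.2 (by omega))
  rw [sum_const, card_range, nsmul_eq_mul, mul_div_cancel₀ _ (by positivity : (J : ℝ) ≠ 0)]
  calc ∑ j ∈ range J, ∑ k ∈ Icc (22 ^ j * T₀) (21 * (22 ^ j * T₀)), G k
      = ∑ k ∈ (range J).biUnion (fun j => Icc (22 ^ j * T₀) (21 * (22 ^ j * T₀))), G k := by
        rw [sum_biUnion (blocks_disjoint hT₀ J)]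
    _ ≤ ∑ k ∈ Ico T₀ (22 ^ J * T₀), G k :=
        sum_le_sum_of_subset_of_nonneg (blocks_subset hT₀ J) fun k _ _ => hG k
    _ ≤ K₂ * D (2 * T₀ - 1) := htail T₀ hT₀ _

/-- `exp(1/5) < 100` (crudely: `exp(1/5) ≤ exp 1 < 3`). [folklore] -/
private theorem exp_one_fifth_lt : Real.exp (1 / 5) < 100 := by
  have h1 : Real.exp (1 / 5) ≤ Real.exp 1 := Real.exp_le_exp.2 (by norm_num)
  have h2 := Real.exp_one_lt_d9
  norm_num at h2
  linarith

/-- `1 ≤ log 72` (`e < 3 ≤ 72`). [folklore] -/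
private theorem one_le_log_72 : (1 : ℝ) ≤ Real.log 72 := by
  rw [Real.le_log_iff_exp_le (by norm_num)]
  have := Real.exp_one_lt_d9
  norm_num at this
  linarith

set_option maxHeartbeats 400000 in
/-- **Recurrence ⇒ polynomial decay with an explicit exponent** (Krachun–Panagiotis's Lemma 3.4,
re-run on their inequality (10) with optimized bookkeeping): under the hypotheses listed in the module
docstring (`D > 0`, `D ≤ C₀`, `D` non-increasing, `G ≥ 0`, tail bound with `K₂`, recurrence (10) with `K`), for every
`J ≥ 1` and every `ε > 0` with `5ε·log(72·22^{J-1}) ≤ 1` and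
`(25/4)·e·K·K₂·(1/(1-ε) + 1/100)² ≤ J`, one has `D_T ≤ 100·C₀·T^{-ε}` for all `T ≥ 1`.
[cite: KrachunPanagiotis2026, Lemma 3.4 (statement shape and proof strategy; constants ours)] -/
theorem decay_of_recurrence {D G : ℕ → ℝ} {C₀ K K₂ ε : ℝ} {J : ℕ}
    (hC₀ : 0 < C₀) (hK : 0 < K) (hK₂ : 0 < K₂) (hDpos : ∀ k, 0 < D k) (hDle : ∀ k, D k ≤ C₀)
    (hDanti : Antitone D) (hG : ∀ k, 0 ≤ G k)
    (htail : ∀ T : ℕ, 1 ≤ T → ∀ N : ℕ, ∑ k ∈ Ico T N, G k ≤ K₂ * D (2 * T - 1))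
    (hrec : ∀ T : ℕ, 1 ≤ T → (T : ℝ) ^ 2 * D (18 * T) ^ 3 ≤
      K * (D ((T + 2) / 2) / D (10 * T) * ∑ i ∈ range (5 * T / 2 + 1), D i) ^ 2 *
        ∑ k ∈ Icc T (21 * T), G k)
    (hJ1 : 1 ≤ J) (hε : 0 < ε) (hεM : ε * (5 * Real.log (72 * 22 ^ (J - 1))) ≤ 1)
    (hJ : 25 / 4 * Real.exp 1 * K * K₂ * (1 / (1 - ε) + 1 / 100) ^ 2 ≤ J) :
    ∀ T : ℕ, 1 ≤ T → D T ≤ 100 * C₀ * (T : ℝ) ^ (-ε) := by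
  -- constants
  set M : ℕ := 18 * 22 ^ (J - 1) with hM
  have hMpos : 0 < M := by rw [hM]; positivity
  have hM18 : 18 ≤ M := by
    rw [hM]; have : 1 ≤ 22 ^ (J - 1) := Nat.one_le_pow _ _ (by norm_num); nlinarith
  set R : ℝ := 72 * 22 ^ (J - 1) with hR
  have hRM : R = 4 * (M : ℝ) := by rw [hR, hM]; push_cast; ring
  have hR72 : 72 ≤ R := by
    rw [hR]; have : (1 : ℝ) ≤ 22 ^ (J - 1) := one_le_pow₀ (by norm_num); nlinarith
  have hRpos : 0 < R := by linarith
  have hlogR : 1 ≤ Real.log R :=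
    one_le_log_72.trans (Real.log_le_log (by norm_num) hR72)
  have hε5 : ε ≤ 1 / 5 := by
    rw [le_div_iff₀ (by norm_num : (0:ℝ) < 5)]; nlinarith
  have h1ε : 0 < 1 - ε := by linarith
  set A : ℝ := 100 * C₀ with hA
  have hApos : 0 < A := by rw [hA]; exact mul_pos (by norm_num) hC₀
  set β : ℝ := 1 / (1 - ε) + 1 / 100 with hβ
  have hβpos : 0 < β := by rw [hβ]; positivity
  set q : ℝ := R ^ ε with hq
  have hqpos : 0 < q := Real.rpow_pos_of_pos hRpos ε
  have hq5 : q ^ 5 ≤ Real.exp 1 := by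
    rw [hq, ← Real.rpow_natCast, ← Real.rpow_mul hRpos.le, Real.rpow_def_of_pos hRpos]
    exact Real.exp_le_exp.2 (by push_cast; nlinarith)
  have hqlam : q * R ^ (-ε) = 1 := by
    rw [Real.rpow_neg hRpos.le, hq, mul_inv_cancel₀ hqpos.ne']
  have hlam0 : 0 ≤ R ^ (-ε) := Real.rpow_nonneg hRpos.le _
  -- the coefficient is ≤ 1
  have hcoef : 25 / 4 * K * K₂ * β ^ 2 * q ^ 5 / J ≤ 1 := by
    have hJpos : (0 : ℝ) < J := by exact_mod_cast hJ1
    rw [div_le_one hJpos]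
    calc 25 / 4 * K * K₂ * β ^ 2 * q ^ 5 ≤ 25 / 4 * K * K₂ * β ^ 2 * Real.exp 1 := by
          have : 0 ≤ 25 / 4 * K * K₂ * β ^ 2 := by
            have := hK; have := hK₂; positivity
          exact mul_le_mul_of_nonneg_left hq5 this
      _ = 25 / 4 * Real.exp 1 * K * K₂ * (1 / (1 - ε) + 1 / 100) ^ 2 := by rw [hβ]; ring
      _ ≤ J := hJ
  -- strong induction on T
  intro T
  induction T using Nat.strong_induction_on with
  | _ T ih =>
  intro hT
  have hTpos : (0 : ℝ) < T := by exact_mod_cast hT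
  have IH : ∀ k : ℕ, 1 ≤ k → k < T → D k ≤ A * (k : ℝ) ^ (-ε) := fun k hk hkT => ih k hkT hk
  by_cases hsmall : (T : ℝ) ^ ε ≤ 100
  · -- small `T`: the a priori bound `D ≤ C₀` suffices
    have hp : 0 < (T : ℝ) ^ ε := Real.rpow_pos_of_pos hTpos ε
    have h1 : 1 ≤ 100 * (T : ℝ) ^ (-ε) := by
      rw [Real.rpow_neg hTpos.le, ← div_eq_mul_inv, le_div_iff₀ hp]; linarith
    calc D T ≤ C₀ := hDle T
      _ = C₀ * 1 := (mul_one _).symm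
      _ ≤ C₀ * (100 * (T : ℝ) ^ (-ε)) := mul_le_mul_of_nonneg_left h1 hC₀.le
      _ = 100 * C₀ * (T : ℝ) ^ (-ε) := by ring
  push Not at hsmall
  -- large `T`: `T > R = 4M`
  have hTR : R < T := by
    by_contra hle
    push Not at hle
    have h1 : (T : ℝ) ^ ε ≤ R ^ ε := Real.rpow_le_rpow hTpos.le hle hε.le
    have h2 : R ^ ε ≤ Real.exp (1 / 5) := by
      rw [Real.rpow_def_of_pos hRpos]
      exact Real.exp_le_exp.2 (by nlinarith)
    have h3 := exp_one_fifth_lt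
    linarith
  have h4MT : 4 * M < T := by
    have : (4 * M : ℝ) < T := by rw [← hRM]; exact hTR
    exact_mod_cast this
  set T₀ : ℕ := T / M with hT₀
  have hT₀4 : 4 ≤ T₀ := by
    rw [hT₀, Nat.le_div_iff_mul_le hMpos]; omega
  have hMT₀ : M * T₀ ≤ T := by rw [hT₀]; exact Nat.mul_div_le T M
  have hTlt : T < M * T₀ + M := by
    have h1 := Nat.div_add_mod T M
    have h2 := Nat.mod_lt T hMpos
    rw [hT₀]; omega
  have hT₀T : T₀ < T := by
    rw [hT₀]; exact Nat.div_lt_self (by omega) (by omega)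
  have hT₀pos : (0 : ℝ) < T₀ := by exact_mod_cast (show 0 < T₀ by omega)
  have hT2M : (T : ℝ) ≤ R * ((T₀ : ℝ) / 2) := by
    rw [hRM]
    have : (T : ℝ) ≤ (M : ℝ) * T₀ + M := by exact_mod_cast hTlt.le
    have hT₀1 : (1 : ℝ) ≤ T₀ := by exact_mod_cast (show 1 ≤ T₀ by omega)
    have hM0 : (0 : ℝ) ≤ M := by positivity
    nlinarith
  have hT4M : (T : ℝ) ≤ R * (T₀ : ℝ) := by
    have := hT2M; nlinarith
  -- `u₀ ≤ q u`
  have hu : 0 < (T : ℝ) ^ (-ε) := Real.rpow_pos_of_pos hTpos _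
  have hu₀pos : 0 < (T₀ : ℝ) ^ (-ε) := Real.rpow_pos_of_pos hT₀pos _
  have hu₀ : (T₀ : ℝ) ^ (-ε) ≤ q * (T : ℝ) ^ (-ε) := by
    have h1 : (R * T₀) ^ (-ε) ≤ (T : ℝ) ^ (-ε) :=
      Real.rpow_le_rpow_of_nonpos hTpos hT4M (by linarith)
    rw [Real.mul_rpow hRpos.le hT₀pos.le] at h1
    calc (T₀ : ℝ) ^ (-ε) = q * (R ^ (-ε) * (T₀ : ℝ) ^ (-ε)) := by
          rw [← mul_assoc, hqlam, one_mul]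
      _ ≤ q * (T : ℝ) ^ (-ε) := mul_le_mul_of_nonneg_left h1 hqpos.le
  -- pigeonhole
  obtain ⟨j, hjJ, hSj⟩ := exists_small_block hG htail (T₀ := T₀) (J := J) (by omega) hJ1
  rw [mem_range] at hjJ
  set t : ℕ := 22 ^ j * T₀ with ht
  have hT₀t : T₀ ≤ t := by
    rw [ht]; exact Nat.le_mul_of_pos_left _ (by positivity)
  have ht4 : 4 ≤ t := hT₀4.trans hT₀t
  have h18t : 18 * t ≤ T := by
    have hp : 22 ^ j ≤ 22 ^ (J - 1) := Nat.pow_le_pow_right (by norm_num) (by omega)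
    calc 18 * t = 18 * 22 ^ j * T₀ := by rw [ht]; ring
      _ ≤ 18 * 22 ^ (J - 1) * T₀ := by gcongr
      _ = M * T₀ := by rw [hM]
      _ ≤ T := hMT₀
  have htpos : (0 : ℝ) < t := by exact_mod_cast (show 0 < t by omega)
  have hT₀t' : (T₀ : ℝ) ≤ t := by exact_mod_cast hT₀t
  -- the block sum, via the induction hypothesis at `T₀`
  have hJpos : (0 : ℝ) < J := by exact_mod_cast hJ1
  have hS : ∑ k ∈ Icc t (21 * t), G k ≤ K₂ * (A * (T₀ : ℝ) ^ (-ε)) / J := by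
    refine hSj.trans ?_
    have h1 : D (2 * T₀ - 1) ≤ D T₀ := hDanti (by omega)
    have h2 : D T₀ ≤ A * (T₀ : ℝ) ^ (-ε) := IH T₀ (by omega) hT₀T
    have := hK₂
    gcongr
    exact h1.trans h2
  have hS0 : 0 ≤ ∑ k ∈ Icc t (21 * t), G k := sum_nonneg fun k _ => hG k
  -- dichotomy
  by_cases hdrop : D (10 * t) < R ^ (-ε) * D ((t + 2) / 2)
  · -- DROP: `D_T ≤ D_{10t} < λ D_{⌈(t+1)/2⌉} ≤ λ A (T₀/2)^{-ε} ≤ A T^{-ε}`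
    have h1 : D T ≤ D (10 * t) := hDanti (by omega)
    have h2 : D ((t + 2) / 2) ≤ A * (((t + 2) / 2 : ℕ) : ℝ) ^ (-ε) :=
      IH _ (by omega) (by omega)
    have h3 : (((t + 2) / 2 : ℕ) : ℝ) ^ (-ε) ≤ ((T₀ : ℝ) / 2) ^ (-ε) := by
      apply Real.rpow_le_rpow_of_nonpos (by positivity) _ (by linarith)
      have : T₀ ≤ 2 * ((t + 2) / 2) := by omega
      have : (T₀ : ℝ) ≤ 2 * (((t + 2) / 2 : ℕ) : ℝ) := by exact_mod_cast this
      linarith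
    have h4 : R ^ (-ε) * ((T₀ : ℝ) / 2) ^ (-ε) ≤ (T : ℝ) ^ (-ε) := by
      rw [← Real.mul_rpow hRpos.le (by positivity)]
      exact Real.rpow_le_rpow_of_nonpos hTpos hT2M (by linarith)
    calc D T ≤ D (10 * t) := h1
      _ ≤ R ^ (-ε) * D ((t + 2) / 2) := hdrop.le
      _ ≤ R ^ (-ε) * (A * ((T₀ : ℝ) / 2) ^ (-ε)) := by
          apply mul_le_mul_of_nonneg_left (h2.trans _) hlam0
          exact mul_le_mul_of_nonneg_left h3 hApos.le
      _ = A * (R ^ (-ε) * ((T₀ : ℝ) / 2) ^ (-ε)) := by ring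
      _ ≤ A * (T : ℝ) ^ (-ε) := mul_le_mul_of_nonneg_left h4 hApos.le
      _ = 100 * C₀ * (T : ℝ) ^ (-ε) := by rw [hA]
  · -- RATIO ≤ q: use the recurrence (10) at `t`
    push Not at hdrop
    have hD10 := hDpos (10 * t)
    have hρ : D ((t + 2) / 2) / D (10 * t) ≤ q := by
      rw [div_le_iff₀ hD10]
      have := mul_le_mul_of_nonneg_left hdrop hqpos.le
      rw [← mul_assoc, hqlam, one_mul] at this
      exact this
    have hρ0 : 0 ≤ D ((t + 2) / 2) / D (10 * t) := (div_pos (hDpos _) hD10).le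
    -- the sum `Σ_{i ≤ ⌊5t/2⌋} D_i ≤ A β (5t/2) T₀^{-ε}`
    set n : ℕ := 5 * t / 2 with hn
    have hnT : n < T := by omega
    have hnle : (n : ℝ) ≤ 5 * (t : ℝ) / 2 := by
      rw [hn]; exact_mod_cast Nat.cast_div_le (m := 5 * t) (n := 2)
    have hn10 : 10 ≤ n := by omega
    have hbase : (10 : ℝ) ≤ 5 * (t : ℝ) / 2 := by
      have : (10 : ℝ) ≤ n := by exact_mod_cast hn10
      linarith
    have hbpos : (0 : ℝ) < 5 * (t : ℝ) / 2 := by linarith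
    set X : ℝ := (5 * (t : ℝ) / 2) ^ (1 - ε) with hX
    have hX1 : 1 ≤ X := Real.one_le_rpow (by linarith) h1ε.le
    have hXle : X ≤ 5 * (t : ℝ) / 2 * (T₀ : ℝ) ^ (-ε) := by
      rw [hX, sub_eq_add_neg, Real.rpow_add hbpos, Real.rpow_one]
      apply mul_le_mul_of_nonneg_left _ hbpos.le
      exact Real.rpow_le_rpow_of_nonpos hT₀pos (by linarith) (by linarith)
    have hsum : ∑ i ∈ range (n + 1), D i ≤ A * β * X := by
      rw [sum_range_succ']
      have h0 : D 0 ≤ A / 100 * X := by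
        calc D 0 ≤ C₀ := hDle 0
          _ = A / 100 * 1 := by rw [hA]; ring
          _ ≤ A / 100 * X := mul_le_mul_of_nonneg_left hX1 (by positivity)
      have h1 : ∑ i ∈ range n, D (i + 1) ≤ A * ((n : ℝ) ^ (1 - ε) / (1 - ε)) := by
        calc ∑ i ∈ range n, D (i + 1) ≤ ∑ i ∈ range n, A * (((i : ℝ) + 1) ^ (-ε)) := by
              refine sum_le_sum fun i hi => ?_
              rw [mem_range] at hi
              have := IH (i + 1) (by omega) (by omega)
              push_cast at this
              exact this
          _ = A * ∑ i ∈ range n, ((i : ℝ) + 1) ^ (-ε) := by rw [mul_sum]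
          _ ≤ A * ((n : ℝ) ^ (1 - ε) / (1 - ε)) :=
              mul_le_mul_of_nonneg_left (sum_rpow_neg_succ_le hε.le (by linarith) n) hApos.le
      have h2 : (n : ℝ) ^ (1 - ε) ≤ X := Real.rpow_le_rpow (by positivity) hnle h1ε.le
      have h3 : A * ((n : ℝ) ^ (1 - ε) / (1 - ε)) ≤ A / (1 - ε) * X := by
        have h2' := div_le_div_of_nonneg_right h2 h1ε.le
        calc A * ((n : ℝ) ^ (1 - ε) / (1 - ε)) ≤ A * (X / (1 - ε)) :=
              mul_le_mul_of_nonneg_left h2' hApos.le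
          _ = A / (1 - ε) * X := by ring
      calc ∑ i ∈ range n, D (i + 1) + D 0 ≤ A / (1 - ε) * X + A / 100 * X := add_le_add (h1.trans h3) h0
        _ = A * β * X := by rw [hβ]; ring
    have hsum0 : 0 ≤ ∑ i ∈ range (n + 1), D i := sum_nonneg fun i _ => (hDpos i).le
    -- `P = ρ Σ ≤ q A β (5t/2) u₀`
    set u₀ : ℝ := (T₀ : ℝ) ^ (-ε) with hu₀def
    have hP : D ((t + 2) / 2) / D (10 * t) * ∑ i ∈ range (n + 1), D i ≤
        q * (A * β * (5 * (t : ℝ) / 2 * u₀)) := by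
      apply mul_le_mul hρ (hsum.trans _) hsum0 hqpos.le
      exact mul_le_mul_of_nonneg_left hXle (by positivity)
    have hP0 : 0 ≤ D ((t + 2) / 2) / D (10 * t) * ∑ i ∈ range (n + 1), D i :=
      mul_nonneg hρ0 hsum0
    -- the recurrence
    have hrec' := hrec t (by omega)
    rw [← hn] at hrec'
    have step1 : (t : ℝ) ^ 2 * D (18 * t) ^ 3 ≤
        K * (q * (A * β * (5 * (t : ℝ) / 2 * u₀))) ^ 2 * (K₂ * (A * u₀) / J) := by
      refine hrec'.trans ?_
      apply mul_le_mul _ hS hS0 (by positivity)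
      exact mul_le_mul_of_nonneg_left (pow_le_pow_left₀ hP0 hP 2) hK.le
    -- rewrite the right-hand side and cancel `t²`
    have step2 : D (18 * t) ^ 3 ≤ 25 / 4 * K * K₂ * β ^ 2 * q ^ 2 * A ^ 3 * u₀ ^ 3 / J := by
      have ht2 : (0 : ℝ) < (t : ℝ) ^ 2 := by positivity
      have : (t : ℝ) ^ 2 * D (18 * t) ^ 3 ≤
          (t : ℝ) ^ 2 * (25 / 4 * K * K₂ * β ^ 2 * q ^ 2 * A ^ 3 * u₀ ^ 3 / J) := by
        refine step1.trans (le_of_eq ?_)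
        field_simp
        ring
      exact le_of_mul_le_mul_left this ht2
    -- `u₀³ ≤ q³ u³`
    have hu₀3 : u₀ ^ 3 ≤ q ^ 3 * ((T : ℝ) ^ (-ε)) ^ 3 := by
      rw [← mul_pow]; exact pow_le_pow_left₀ hu₀pos.le hu₀ 3
    have step3 : D (18 * t) ^ 3 ≤ (25 / 4 * K * K₂ * β ^ 2 * q ^ 5 / J) * (A * (T : ℝ) ^ (-ε)) ^ 3 := by
      refine step2.trans ?_
      have hc : 0 ≤ 25 / 4 * K * K₂ * β ^ 2 * q ^ 2 * A ^ 3 / J := by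
        have := hK₂; positivity
      calc 25 / 4 * K * K₂ * β ^ 2 * q ^ 2 * A ^ 3 * u₀ ^ 3 / J
          = (25 / 4 * K * K₂ * β ^ 2 * q ^ 2 * A ^ 3 / J) * u₀ ^ 3 := by ring
        _ ≤ (25 / 4 * K * K₂ * β ^ 2 * q ^ 2 * A ^ 3 / J) * (q ^ 3 * ((T : ℝ) ^ (-ε)) ^ 3) :=
            mul_le_mul_of_nonneg_left hu₀3 hc
        _ = (25 / 4 * K * K₂ * β ^ 2 * q ^ 5 / J) * (A * (T : ℝ) ^ (-ε)) ^ 3 := by ring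
    have hAu : 0 ≤ A * (T : ℝ) ^ (-ε) := by positivity
    have step4 : D (18 * t) ^ 3 ≤ (A * (T : ℝ) ^ (-ε)) ^ 3 := by
      refine step3.trans ?_
      calc (25 / 4 * K * K₂ * β ^ 2 * q ^ 5 / J) * (A * (T : ℝ) ^ (-ε)) ^ 3
          ≤ 1 * (A * (T : ℝ) ^ (-ε)) ^ 3 := mul_le_mul_of_nonneg_right hcoef (pow_nonneg hAu 3)
        _ = (A * (T : ℝ) ^ (-ε)) ^ 3 := one_mul _
    have h1 : D T ≤ D (18 * t) := hDanti h18t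
    have h2 : D T ^ 3 ≤ (A * (T : ℝ) ^ (-ε)) ^ 3 :=
      (pow_le_pow_left₀ (hDpos T).le h1 3).trans step4
    have h3 : D T ≤ A * (T : ℝ) ^ (-ε) := le_of_pow_le_pow_left₀ (by norm_num) hAu h2
    rw [hA] at h3
    exact h3


end KrachunPanagiotis

end Literature.Probability.RandomPlanarGeometry
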